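import Summits.QuantumFields.YangMills.Theses.PencilRigidity
import Summits.QuantumFields.YangMills.Theorems.HypercubicLimit.Negative.NonabelianLoadBearing
import Summits.QuantumFields.YangMills.Theorems.HypercubicLimit.Negative.AllTimesGapFalse

/-!
# `WeakCouplingHypercubicLimit` (crux stmt-QuantumFields-16120, route PencilRigidity) — negative side:
# non-abelianness is load-bearing; the all-times lattice gap and bounded-`β` schemes kill the body

Support file extracted from the standing disprover\'s work file
`Cruxes/WeakCouplingHypercubicLimit/Disproof.lean` §§3–5 (cycle 1).  The crux body is quoted VERBATIM
(weak coupling `sch.HasWeakCouplingLimit`, one-field gauge, the OS block, `Converges`, non-triviality,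
non-Gaussianity, the two gaps); nothing is defined or posited.

* `weakCouplingHypercubicLimit_false_without_nonabelian`: with `IsCompactSimpleLieGroup G` weakened to
  "connected, with a faithful continuous unitary representation" the statement is FALSE — `G = PUnit`
  (the sibling crux\'s determinism bridge `not_converges_and_twoPointNontrivial_of_subsingleton`:
  `Converges` forces factorisation on real tensors, killing non-triviality).  The new weak-coupling and
  one-field clauses do not interact with it: non-commutativity of `G` is used by any proof, and enters
  only through the non-triviality clause.
* `weakCouplingHypercubicLimit_body_false_with_allTimesGap`: the body with `HasLatticeMassGap`
  strengthened by dropping the restriction `n ≤ S` on the time separation is FALSE for every compact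
  simple `G`, every `r`, every scheme, every family (torus correlations are periodic; the curvature has
  positive variance under every Wilson measure — sibling\'s `not_hasLatticeMassGapAllTimes`).
* `weakCouplingHypercubicLimit_body_false_of_beta_le`: no family rides a scheme with bounded inverse
  coupling (fixed / strong coupling, or a finite-`β` lattice critical point): the clause added by the
  statement re-type of 2026-08-16 at work. [folklore]
-/

noncomputable section

open scoped SchwartzMap
open MeasureTheory Filter Topology Complex
open Literature.MathematicalPhysics.AQFT Literature.MathematicalPhysics.QuantumLattice
open Literature.MathematicalPhysics.QuantumFieldTheory
open Summit.QuantumFields.YangMills.Theorems.HypercubicLimit.Negative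

namespace Summit.QuantumFields.YangMills.Theorems.WeakCouplingHypercubicLimit.Negative

/-- **The crux is FALSE without "non-abelian"**: weakening the hypothesis `IsCompactSimpleLieGroup G`
of `PencilRigidity.WeakCouplingHypercubicLimit` to "compact, connected, with a faithful continuous
unitary representation" makes it false (witness `G = PUnit`), already at the level of
`Converges ∧` non-triviality; the weak-coupling, one-field, OS and gap clauses play no role. [folklore] -/
theorem weakCouplingHypercubicLimit_false_without_nonabelian :
    ¬ (∀ (G : Type) [Group G] [TopologicalSpace G] [IsTopologicalGroup G] [CompactSpace G],
        ConnectedSpace G → Nonempty (LatticeRep G) →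
          letI : MeasurableSpace G := borel G
          haveI : BorelSpace G := ⟨rfl⟩
          ∃ (r : LatticeRep G) (sch : SpeciesScheme (YMSpecies G)) (S : LabelledSchwingerFamily (YMSpecies G) (EuclideanSpace ℝ (Fin 4))), 
            sch.HasWeakCouplingLimit ∧ (∀ (n : ℕ) (k : Fin n → YMSpecies G), (∃ i, k i ≠ r.curvature) → ∀ F : SchwartzMap (Fin n → (EuclideanSpace ℝ (Fin 4))) ℂ, S n k F = 0) ∧ (S.IsNormalized ∧ S.IsHermitian ∧ S.HasLinearGrowth ∧ S.IsReflectionPositive ∧ S.IsSymmetric ∧ S.HasClusterProperty ∧ (∀ (n : ℕ) (k : Fin n → YMSpecies G) (a : (EuclideanSpace ℝ (Fin 4))) (F : SchwartzMap (Fin n → (EuclideanSpace ℝ (Fin 4))) ℂ), IsOffDiagonal F → S n k (translateMulti a F) = S n k F) ∧ (∀ (n : ℕ) (k : Fin n → YMSpecies G) (R : (EuclideanSpace ℝ (Fin 4)) ≃ₗᵢ[ℝ] (EuclideanSpace ℝ (Fin 4))), LinearMap.det (R.toLinearEquiv : (EuclideanSpace ℝ (Fin 4)) →ₗ[ℝ]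 (EuclideanSpace ℝ (Fin 4))) = 1 → (∀ i : Fin 4, ∃ j : Fin 4, R (EuclideanSpace.single i 1) = EuclideanSpace.single j 1 ∨ R (EuclideanSpace.single i 1) = -EuclideanSpace.single j 1) → ∀ F : SchwartzMap (Fin n → (EuclideanSpace ℝ (Fin 4))) ℂ, IsOffDiagonal F → S n k (linActMulti R F) = S n k F)) ∧ (∀ (n : ℕ), n ≠ 0 → ∀ (σ : Fin n → YMSpecies G) (f : Fin n → SchwartzMap (EuclideanSpace ℝ (Fin 4)) ℝ) (F : SchwartzMap (Fin n → (EuclideanSpace ℝ (Fin 4))) ℂ), IsTensorOf F (fun i => ofRealTest (f i)) → IsOffDiagonal F → Filter.Tendsto (fun k : ℕ => ((latticeSchwinger r.ρ sch (fun s => s.F) k n σ f : ℝ) : ℂ)) Filter.atTop (nhds (S n σ F))) ∧ (∃ (F₁ G₁ : SchwartzMap (Fin 1 → (EuclideanSpace ℝ (Fin 4))) ℂ) (H₁ : SchwartzMap (Fin (1 + 1) → (EuclideanSpace ℝ (Fin 4))) ℂ), IsTimeOrdered F₁ ∧ IsTimeOrdered G₁ ∧ IsAppendTensorOf H₁ (osAdjoint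 F₁) G₁ ∧ S (1 + 1) (fun _ => r.curvature) H₁ ≠ S 1 (fun _ => r.curvature) (osAdjoint F₁) * S 1 (fun _ => r.curvature) G₁) ∧ (∃ (f g h : SchwartzMap (EuclideanSpace ℝ (Fin 4)) ℂ) (Ffgh : SchwartzMap (Fin 3 → (EuclideanSpace ℝ (Fin 4))) ℂ) (Fgh Ffh Ffg : SchwartzMap (Fin 2 → (EuclideanSpace ℝ (Fin 4))) ℂ) (Ff Fg Fh : SchwartzMap (Fin 1 → (EuclideanSpace ℝ (Fin 4))) ℂ), IsTensorOf Ffgh ![f, g, h] ∧ IsOffDiagonal Ffgh ∧ IsTensorOf Fgh ![g, h] ∧ IsTensorOf Ffh ![f, h] ∧ IsTensorOf Ffg ![f, g] ∧ IsTensorOf Ff ![f] ∧ IsTensorOf Fg ![g] ∧ IsTensorOf Fh ![h] ∧ S 3 (fun _ => r.curvature) Ffgh - S 1 (fun _ => r.curvature) Ff * S 2 (fun _ => r.curvature) Fgh - S 1 (fun _ => r.curvature) Fg * S 2 (fun _ => r.curvature) Ffh - S 1 (fun _ => r.curvature) Fh * S 2 (fun _ => r.curvature) Ffg + 2 * (S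 1 (fun _ => r.curvature) Ff * S 1 (fun _ => r.curvature) Fg * S 1 (fun _ => r.curvature) Fh) ≠ 0) ∧ (∃ Δ : ℝ, 0 < Δ ∧ S.HasMassGap Δ ∧ HasLatticeMassGap r sch Δ)) := by
  intro h
  letI : MeasurableSpace PUnit := borel PUnit
  haveI : BorelSpace PUnit := ⟨rfl⟩
  obtain ⟨r, sch, S, -, -, -, hconv, hnt, -⟩ := h PUnit inferInstance ⟨punitRep⟩
  exact not_converges_and_twoPointNontrivial_of_subsingleton r sch S hconv hnt

section PerGroup

variable {G : Type} [Group G] [TopologicalSpace G] [IsTopologicalGroup G] [CompactSpace G]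
  [MeasurableSpace G] [BorelSpace G]

/-- **The all-times strengthening of the lattice gap kills the crux body** for every compact simple
`G` (indeed every non-abelian compact `G`), every `r`, every scheme and every family: the body of
`PencilRigidity.WeakCouplingHypercubicLimit` with `∀ n ≤ S` replaced by `∀ n` in `HasLatticeMassGap`
is unsatisfiable.  The restriction `n ≤ S` is essential, with or without weak coupling. [folklore] -/
theorem weakCouplingHypercubicLimit_body_false_with_allTimesGap (hG : IsCompactSimpleLieGroup G)
    (r : LatticeRep G) (sch : SpeciesScheme (YMSpecies G))
    (S : LabelledSchwingerFamily (YMSpecies G) (EuclideanSpace ℝ (Fin 4))) :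
    ¬ (sch.HasWeakCouplingLimit ∧ (∀ (n : ℕ) (k : Fin n → YMSpecies G), (∃ i, k i ≠ r.curvature) → ∀ F : SchwartzMap (Fin n → (EuclideanSpace ℝ (Fin 4))) ℂ, S n k F = 0) ∧ (S.IsNormalized ∧ S.IsHermitian ∧ S.HasLinearGrowth ∧ S.IsReflectionPositive ∧ S.IsSymmetric ∧ S.HasClusterProperty ∧ (∀ (n : ℕ) (k : Fin n → YMSpecies G) (a : (EuclideanSpace ℝ (Fin 4))) (F : SchwartzMap (Fin n → (EuclideanSpace ℝ (Fin 4))) ℂ), IsOffDiagonal F → S n k (translateMulti a F) = S n k F) ∧ (∀ (n : ℕ) (k : Fin n → YMSpecies G) (R : (EuclideanSpace ℝ (Fin 4)) ≃ₗᵢ[ℝ] (EuclideanSpace ℝ (Fin 4))), LinearMap.det (R.toLinearEquiv : (EuclideanSpace ℝ (Fin 4)) →ₗ[ℝ] (EuclideanSpace ℝ (Fin 4))) = 1 → (∀ i : Fin 4, ∃ j : Fin 4, R (EuclideanSpace.single i 1) = EuclideanSpace.single j 1 ∨ R (EuclideanSpace.single i 1) = -EuclideanSpace.single j 1) → ∀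 F : SchwartzMap (Fin n → (EuclideanSpace ℝ (Fin 4))) ℂ, IsOffDiagonal F → S n k (linActMulti R F) = S n k F)) ∧ (∀ (n : ℕ), n ≠ 0 → ∀ (σ : Fin n → YMSpecies G) (f : Fin n → SchwartzMap (EuclideanSpace ℝ (Fin 4)) ℝ) (F : SchwartzMap (Fin n → (EuclideanSpace ℝ (Fin 4))) ℂ), IsTensorOf F (fun i => ofRealTest (f i)) → IsOffDiagonal F → Filter.Tendsto (fun k : ℕ => ((latticeSchwinger r.ρ sch (fun s => s.F) k n σ f : ℝ) : ℂ)) Filter.atTop (nhds (S n σ F))) ∧ (∃ (F₁ G₁ : SchwartzMap (Fin 1 → (EuclideanSpace ℝ (Fin 4))) ℂ) (H₁ : SchwartzMap (Fin (1 + 1) → (EuclideanSpace ℝ (Fin 4))) ℂ), IsTimeOrdered F₁ ∧ IsTimeOrdered G₁ ∧ IsAppendTensorOf H₁ (osAdjoint F₁) G₁ ∧ S (1 + 1) (fun _ => r.curvature) H₁ ≠ S 1 (fun _ => r.curvature) (osAdjoint F₁) * S 1 (fun _ => r.curvature) G₁) ∧ (∃ (f g h : SchwartzMap (EuclideanSpace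 ℝ (Fin 4)) ℂ) (Ffgh : SchwartzMap (Fin 3 → (EuclideanSpace ℝ (Fin 4))) ℂ) (Fgh Ffh Ffg : SchwartzMap (Fin 2 → (EuclideanSpace ℝ (Fin 4))) ℂ) (Ff Fg Fh : SchwartzMap (Fin 1 → (EuclideanSpace ℝ (Fin 4))) ℂ), IsTensorOf Ffgh ![f, g, h] ∧ IsOffDiagonal Ffgh ∧ IsTensorOf Fgh ![g, h] ∧ IsTensorOf Ffh ![f, h] ∧ IsTensorOf Ffg ![f, g] ∧ IsTensorOf Ff ![f] ∧ IsTensorOf Fg ![g] ∧ IsTensorOf Fh ![h] ∧ S 3 (fun _ => r.curvature) Ffgh - S 1 (fun _ => r.curvature) Ff * S 2 (fun _ => r.curvature) Fgh - S 1 (fun _ => r.curvature) Fg * S 2 (fun _ => r.curvature) Ffh - S 1 (fun _ => r.curvature) Fh * S 2 (fun _ => r.curvature) Ffg + 2 * (S 1 (fun _ => r.curvature) Ff * S 1 (fun _ => r.curvature) Fg * S 1 (fun _ => r.curvature) Fh) ≠ 0) ∧ (∃ Δ : ℝ, 0 < Δ ∧ S.HasMassGap Δ ∧ ∀ A B : YMSpecies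 G, ∃ C : ℝ, ∀ᶠ k in Filter.atTop, ∀ S' : ℕ, sch.L k ≤ S' → ∀ n : ℕ, |latticeConnectedCorr r.ρ (sch.β k) (2 * S' + 1) A.F B.F n| ≤ C * Real.exp (-(Δ * (sch.a k * n))))) := by
  intro h
  obtain ⟨Δ, hΔ, -, hall⟩ := h.2.2.2.2.2.2
  exact not_hasLatticeMassGapAllTimes hG.1.2.1 r sch hΔ hall

/-- **Bounded-`β` schemes carry no witness**: the body of `PencilRigidity.WeakCouplingHypercubicLimit`
fails for every scheme whose inverse bare coupling is bounded above — fixed coupling, strong coupling,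
or a "continuum limit" at a finite-`β` critical point of Wilson's lattice theory are all excluded by
the weak-coupling clause alone. [folklore] -/
theorem weakCouplingHypercubicLimit_body_false_of_beta_le (r : LatticeRep G)
    (sch : SpeciesScheme (YMSpecies G)) (S : LabelledSchwingerFamily (YMSpecies G) (EuclideanSpace ℝ (Fin 4)))
    {B : ℝ} (hB : ∀ k, sch.β k ≤ B) :
    ¬ (sch.HasWeakCouplingLimit ∧ (∀ (n : ℕ) (k : Fin n → YMSpecies G), (∃ i, k i ≠ r.curvature) → ∀ F : SchwartzMap (Fin n → (EuclideanSpace ℝ (Fin 4))) ℂ, S n k F = 0) ∧ (S.IsNormalized ∧ S.IsHermitian ∧ S.HasLinearGrowth ∧ S.IsReflectionPositive ∧ S.IsSymmetric ∧ S.HasClusterProperty ∧ (∀ (n : ℕ) (k : Fin n → YMSpecies G) (a : (EuclideanSpace ℝ (Fin 4))) (F : SchwartzMap (Fin n → (EuclideanSpace ℝ (Fin 4))) ℂ), IsOffDiagonal F → S n k (translateMulti a F) = S n k F) ∧ (∀ (n : ℕ) (k : Fin n → YMSpecies G) (R : (EuclideanSpace ℝ (Fin 4)) ≃ₗᵢ[ℝ]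 (EuclideanSpace ℝ (Fin 4))), LinearMap.det (R.toLinearEquiv : (EuclideanSpace ℝ (Fin 4)) →ₗ[ℝ] (EuclideanSpace ℝ (Fin 4))) = 1 → (∀ i : Fin 4, ∃ j : Fin 4, R (EuclideanSpace.single i 1) = EuclideanSpace.single j 1 ∨ R (EuclideanSpace.single i 1) = -EuclideanSpace.single j 1) → ∀ F : SchwartzMap (Fin n → (EuclideanSpace ℝ (Fin 4))) ℂ, IsOffDiagonal F → S n k (linActMulti R F) = S n k F)) ∧ (∀ (n : ℕ), n ≠ 0 → ∀ (σ : Fin n → YMSpecies G) (f : Fin n → SchwartzMap (EuclideanSpace ℝ (Fin 4)) ℝ) (F : SchwartzMap (Fin n → (EuclideanSpace ℝ (Fin 4))) ℂ), IsTensorOf F (fun i => ofRealTest (f i)) → IsOffDiagonal F → Filter.Tendsto (fun k : ℕ => ((latticeSchwinger r.ρ sch (fun s => s.F) k n σ f : ℝ) : ℂ)) Filter.atTop (nhds (S n σ F))) ∧ (∃ (F₁ G₁ : SchwartzMap (Fin 1 → (EuclideanSpace ℝ (Fin 4))) ℂ) (H₁ : SchwartzMap (Fin (1 + 1) → (EuclideanSpace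 ℝ (Fin 4))) ℂ), IsTimeOrdered F₁ ∧ IsTimeOrdered G₁ ∧ IsAppendTensorOf H₁ (osAdjoint F₁) G₁ ∧ S (1 + 1) (fun _ => r.curvature) H₁ ≠ S 1 (fun _ => r.curvature) (osAdjoint F₁) * S 1 (fun _ => r.curvature) G₁) ∧ (∃ (f g h : SchwartzMap (EuclideanSpace ℝ (Fin 4)) ℂ) (Ffgh : SchwartzMap (Fin 3 → (EuclideanSpace ℝ (Fin 4))) ℂ) (Fgh Ffh Ffg : SchwartzMap (Fin 2 → (EuclideanSpace ℝ (Fin 4))) ℂ) (Ff Fg Fh : SchwartzMap (Fin 1 → (EuclideanSpace ℝ (Fin 4))) ℂ), IsTensorOf Ffgh ![f, g, h] ∧ IsOffDiagonal Ffgh ∧ IsTensorOf Fgh ![g, h] ∧ IsTensorOf Ffh ![f, h] ∧ IsTensorOf Ffg ![f, g] ∧ IsTensorOf Ff ![f] ∧ IsTensorOf Fg ![g] ∧ IsTensorOf Fh ![h] ∧ S 3 (fun _ => r.curvature) Ffgh - S 1 (fun _ => r.curvature) Ff * S 2 (fun _ => r.curvature) Fgh - S 1 (fun _ => r.curvature)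 Fg * S 2 (fun _ => r.curvature) Ffh - S 1 (fun _ => r.curvature) Fh * S 2 (fun _ => r.curvature) Ffg + 2 * (S 1 (fun _ => r.curvature) Ff * S 1 (fun _ => r.curvature) Fg * S 1 (fun _ => r.curvature) Fh) ≠ 0) ∧ (∃ Δ : ℝ, 0 < Δ ∧ S.HasMassGap Δ ∧ HasLatticeMassGap r sch Δ)) :=
  fun h => SpeciesScheme.not_hasWeakCouplingLimit_of_le sch hB h.1

end PerGroup

end Summit.QuantumFields.YangMills.Theorems.WeakCouplingHypercubicLimit.Negative

end
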